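import Summits.AtomisticToContinuum.HydrodynamicLimit.Theorems.LambertianContactSwapLambertianEulerShellCountTail
import Summits.AtomisticToContinuum.HydrodynamicLimit.Theorems.LambertianContactSwapLambertianEulerMarkedContactsMean
import Summits.AtomisticToContinuum.HydrodynamicLimit.Theorems.LambertianContactSwapLambertianEulerMarkedContactsStatics
import Summits.AtomisticToContinuum.HydrodynamicLimit.Theorems.LambertianContactSwapLambertianEulerCellCharging
import Summits.AtomisticToContinuum.HydrodynamicLimit.Theorems.LambertianContactSwapLambertianEulerTorusNoFastRecollision
import Summits.AtomisticToContinuum.HydrodynamicLimit.Theorems.LambertianContactSwapLambertianEulerWindowCountTools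
import Summits.AtomisticToContinuum.HydrodynamicLimit.Theorems.LambertianContactSwapLambertianEulerWindowCountArith
import HarnessLib

/-!
# Upper-tail concentration of the window collision count of the Lambertian gas at equilibrium
# (`LambertianContactSwap.LambertianEuler`, stmt-AtomisticToContinuum-11854, line `Sketch`; lead c10,
# registered stub `windowCountOverflow_equilibrium_le` — the equilibrium floor of CAT-core (ii))

Support file (`--supports stmt-AtomisticToContinuum-11854`).  `N + 1` hard spheres of diameter
`ε = hsDiameter σ N = σ (N+1)^{-1/3}` on `𝕋³`, Lambertian recursion (`K_s = lambertCount`), rung-0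
equilibrium law `G_N` (constant profiles), `μ := G_N ⊗ γ^ℕ`.  THEOREM: for `0 < σ < 1/2`, `v₁σ³ ≤ 1/2`
there is `R₀ ≥ 1` such that for every `η > 0`, `h₀ > 0`, eventually in `N`, for all flows and windows
`0 ≤ a'`, `h ∈ [h₀, 2h₀]`: `∫⁻ ((K_{a'+h} − K_{a'}) − R₀ h (N+1)^{4/3})₊ dμ ≤ η h (N+1)^{4/3}` — the upper tail
of the window collision count self-averages at the scale of its mean; with `η := (A/σ)V⁻²e^{−aV²}` this is
term (ii) of the input CAT-core (`stub_collisionActivityTailsCore`) at GLOBAL equilibrium, same shell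
`∃R₀ ∀V ∀h₀ ∃N₀` (lead c9 had the mean, `…EquilibriumCollisionRate`, and term (i), `…FastPairActivity`).
PROOF (cell charging): cells of width `δ = κε` (`(N+1)²ε²δ = κσ³(N+1)`), `J = ⌈h/δ⌉`; a.e.
`K_{a'+h} − K_{a'} ≤ Σ_{j<J} F_δ(Λ_{a'+jδ}) + 3·MS` (`…CellChargingPath.windowCount_le_of_noRecollision`, torus
facts of `…CellCharging`, no fast re-collision `…TorusNoFastRecollision`, `L = 1/2`), and
`J C₀(N+1)²ε²δ ≤ 2C₀σ²h(N+1)^{4/3}` (`R₀ = 2C₀σ² + 1`); CELLS: stationarity (`lintegral_comp_lambertFlow_eq`) +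
the `N`-uniform static upper tail `…ShellCountTail.shellCount_overflow_le`; MARKS: Campbell's bound
`…MarkedContactsMean.lintegral_configMarkedContacts_le` (transport `…WindowCountTools.markInd_freeFlight_le`)
+ statics `…MarkedContactsStatics.localGibbsLaw_markedShell_le`; bookkeeping `…WindowCountArith.cells_bookkeeping`.
References: Daley–Vere-Jones I §3.3, §6.4; Cercignani–Illner–Pulvirenti 1994 §2.2; Janson–Łuczak–Ruciński §6.1.
All statements [folklore] given the landed sub-goals.
-/

noncomputable section

namespace Summit.AtomisticToContinuum.HydrodynamicLimit.Theorems.LambertianContactSwapLambertianEulerWindowCountConcentration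

open scoped BigOperators Topology ENNReal InnerProductSpace
open MeasureTheory ProbabilityTheory Filter Set
open Literature.MathematicalPhysics.KineticTheory Literature.MathematicalPhysics.StatisticalMechanics
open Literature.Analysis.FluidPDE Literature.Analysis.FluidPDE.Alexander
open Summit.AtomisticToContinuum.HydrodynamicLimit.Theorems.LambertianContactSwapLambertianEulerEquilibriumCountStationarity
open Summit.AtomisticToContinuum.HydrodynamicLimit.Theorems.LambertianContactSwapLambertianEulerEquilibriumCollisionRate
open Summit.AtomisticToContinuum.HydrodynamicLimit.Theorems.LambertianContactSwapLambertianEulerSimpleCollisions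
open Summit.AtomisticToContinuum.HydrodynamicLimit.Theorems.LambertianContactSwapLambertianEulerRestartInLaw
open Summit.AtomisticToContinuum.HydrodynamicLimit.Theorems.LambertianContactSwapLambertianEulerFastPairActivity
open Summit.AtomisticToContinuum.HydrodynamicLimit.Theorems.LambertianContactSwapLambertianEulerShellCountTail
open Summit.AtomisticToContinuum.HydrodynamicLimit.Theorems.LambertianContactSwapLambertianEulerMarkedContactsMean
open Summit.AtomisticToContinuum.HydrodynamicLimit.Theorems.LambertianContactSwapLambertianEulerMarkedContactsStatics
open Summit.AtomisticToContinuum.HydrodynamicLimit.Theorems.LambertianContactSwapLambertianEulerCellChargingPath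
open Summit.AtomisticToContinuum.HydrodynamicLimit.Theorems.LambertianContactSwapLambertianEulerCellCharging
open Summit.AtomisticToContinuum.HydrodynamicLimit.Theorems.LambertianContactSwapLambertianEulerTorusNoFastRecollision
open Summit.AtomisticToContinuum.HydrodynamicLimit.Theorems.LambertianContactSwapLambertianEulerWindowCountTools
open Summit.AtomisticToContinuum.HydrodynamicLimit.Theorems.LambertianContactSwapLambertianEulerWindowCountArith

/-! ## The theorem -/

/-- **Upper-tail concentration of the window collision count of the Lambertian gas at global
equilibrium** (registered stub `windowCountOverflow_equilibrium_le` of lead c10; the equilibrium floor of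
term (ii) of CAT-core).  For constant profiles `b, ϑ > 0`, `w` and `0 < σ < 1/2`, `v₁σ³ ≤ 1/2` there is
`R₀ ≥ 1` such that for every `η > 0` and `h₀ > 0` there is `N₀` with: for all `N ≥ N₀`, all flows `Φ`,
all `0 ≤ a'` and `h₀ ≤ h ≤ 2h₀`,
`∫⁻ ofReal((K_{a'+h} − K_{a'}) − R₀ h (N+1)^{4/3}) d(G_N ⊗ γ^ℕ) ≤ ofReal(η h (N+1)^{4/3})` — cell charging
a.e., stationarity + the static upper tail for the cells, Campbell + statics for the marked contacts.
[folklore] -/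
theorem windowCountOverflow_equilibrium_le :
    ∀ (b ϑ : ℝ) (w : V3), 0 < b → 0 < ϑ → ∀ σ : ℝ, 0 < σ → σ < 2⁻¹ → v₁ * σ ^ 3 ≤ 1 / 2 →
      ∃ R₀ : ℝ, 1 ≤ R₀ ∧ ∀ η : ℝ, 0 < η → ∀ h₀ : ℝ, 0 < h₀ → ∃ N₀ : ℕ, ∀ N : ℕ, N₀ ≤ N →
        ∀ (Φ : HardSphereFlow (Torus.geometry (Fin 3)) (hsDiameter σ N) (N + 1)) (a' h : ℝ),
          0 ≤ a' → h₀ ≤ h → h ≤ 2 * h₀ →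
          ∫⁻ p, ENNReal.ofReal
              ((((lambertCount (Torus.geometry (Fin 3)) (hsDiameter σ N) p.2 p.1 (a' + h) : ℕ) : ℝ) -
                  ((lambertCount (Torus.geometry (Fin 3)) (hsDiameter σ N) p.2 p.1 a' : ℕ) : ℝ)) -
                R₀ * h * ((N : ℝ) + 1) ^ (4 / 3 : ℝ))
            ∂((localGibbsLaw σ (fun _ => b) (fun _ => w) (fun _ => ϑ) N Φ).prod (lambertNoise (Fin 3))) ≤
          ENNReal.ofReal (η * h * ((N : ℝ) + 1) ^ (4 / 3 : ℝ)) := by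
  intro b ϑ w hb hϑ σ hσ hσ' hlam
  have hσ2 : σ < 1 / 2 := by simpa only [one_div] using hσ'
  obtain ⟨C₀, hC₀, hTail⟩ := shellCount_overflow_le b ϑ w hb hϑ
  obtain ⟨Cm, hCm, hMark⟩ := localGibbsLaw_markedShell_le b ϑ w hb hϑ
  refine ⟨2 * C₀ * σ ^ 2 + 1, by nlinarith [mul_nonneg (mul_nonneg zero_le_two hC₀.le) (sq_nonneg σ)], ?_⟩
  intro η hη h₀ hh₀
  -- the cell parameter `κ`, the tail tolerance `η'`, the linear lower bound `s₀` of the cell mean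
  obtain ⟨κ, hκ⟩ : ∃ κ : ℝ, κ = min 2⁻¹ (min (η / (18 * Cm * σ ^ 5)) (2 * η / (9 * Cm * σ ^ 2))) := ⟨_, rfl⟩
  have hκpos : 0 < κ := by
    rw [hκ, lt_min_iff, lt_min_iff]
    exact ⟨by norm_num, by positivity, by positivity⟩
  have hκhalf : κ ≤ 2⁻¹ := hκ ▸ min_le_left _ _
  have hκ1 : κ ≤ η / (18 * Cm * σ ^ 5) := hκ ▸ (min_le_right _ _).trans (min_le_left _ _)
  have hκ2 : κ ≤ 2 * η / (9 * Cm * σ ^ 2) := hκ ▸ (min_le_right _ _).trans (min_le_right _ _)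
  have hκle1 : κ ≤ 1 := hκhalf.trans (by norm_num)
  obtain ⟨η', hη'⟩ : ∃ η' : ℝ, η' = η / (6 * σ ^ 2) := ⟨_, rfl⟩
  have hη'pos : 0 < η' := by rw [hη']; positivity
  obtain ⟨s₀, hs₀⟩ : ∃ s₀ : ℝ, s₀ = κ * σ ^ 3 := ⟨_, rfl⟩
  have hs₀pos : 0 < s₀ := by rw [hs₀]; positivity
  obtain ⟨M₀, hM₀⟩ := hTail η' hη'pos s₀ hs₀pos
  refine ⟨⌈max (64 * σ ^ 3) (max (σ ^ 3 * (κ / h₀) ^ 3) (M₀ / s₀))⌉₊, ?_⟩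
  intro N hN Φ a' h ha' hh₀h hh2
  -- sizes in `N`
  have hN1 : (0 : ℝ) < (N : ℝ) + 1 := by positivity
  have hmax : max (64 * σ ^ 3) (max (σ ^ 3 * (κ / h₀) ^ 3) (M₀ / s₀)) ≤ (N : ℝ) + 1 := by
    have h2 : ((⌈max (64 * σ ^ 3) (max (σ ^ 3 * (κ / h₀) ^ 3) (M₀ / s₀))⌉₊ : ℕ) : ℝ) ≤ (N : ℝ) := by
      exact_mod_cast hN
    linarith only [Nat.le_ceil (max (64 * σ ^ 3) (max (σ ^ 3 * (κ / h₀) ^ 3) (M₀ / s₀))), h2]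
  have hT1 : 64 * σ ^ 3 ≤ (N : ℝ) + 1 := (le_max_left _ _).trans hmax
  have hT2 : σ ^ 3 * (κ / h₀) ^ 3 ≤ (N : ℝ) + 1 := ((le_max_left _ _).trans (le_max_right _ _)).trans hmax
  have hT3 : M₀ / s₀ ≤ (N : ℝ) + 1 := ((le_max_right _ _).trans (le_max_right _ _)).trans hmax
  -- the diameter `ε`, the cell width `δ = κ ε`, the number of cells `J`, the cell mean `μc`
  have hεpos : 0 < hsDiameter σ N := hsDiameter_pos hσ N
  have hε3 : ((N : ℝ) + 1) * hsDiameter σ N ^ 3 = σ ^ 3 := by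
    have e := succ_mul_hsDiameter_pow_three σ N; push_cast at e; exact e
  have hεcube : ∀ t : ℝ, 0 < t → σ ^ 3 ≤ ((N : ℝ) + 1) * t ^ 3 → hsDiameter σ N ≤ t := fun t ht hle =>
    le_of_pow_three_le hεpos.le ht.le (le_of_mul_le_mul_left (by rw [hε3]; exact hle) hN1)
  have hε4 : hsDiameter σ N ≤ 1 / 4 := hεcube (1 / 4) (by norm_num) (by linarith only [hT1])
  have hεσ : hsDiameter σ N ≤ σ := hsDiameter_le hσ.le N
  obtain ⟨δ, hδ⟩ : ∃ δ : ℝ, δ = κ * hsDiameter σ N := ⟨_, rfl⟩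
  have hδpos : 0 < δ := by rw [hδ]; exact mul_pos hκpos hεpos
  have h2δ : 2 * δ ≤ hsDiameter σ N := by rw [hδ]; nlinarith only [hκhalf, hεpos]
  have hδε : δ ≤ hsDiameter σ N := by linarith only [h2δ, hδpos]
  have hδh₀ : δ ≤ h₀ := by
    have h1 : hsDiameter σ N ≤ h₀ / κ := by
      refine hεcube (h₀ / κ) (by positivity) ?_
      have e : σ ^ 3 * (κ / h₀) ^ 3 * (h₀ / κ) ^ 3 = σ ^ 3 := by field_simp
      calc σ ^ 3 = σ ^ 3 * (κ / h₀) ^ 3 * (h₀ / κ) ^ 3 := e.symm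
        _ ≤ ((N : ℝ) + 1) * (h₀ / κ) ^ 3 := mul_le_mul_of_nonneg_right hT2 (by positivity)
    rw [hδ]
    calc κ * hsDiameter σ N ≤ κ * (h₀ / κ) := mul_le_mul_of_nonneg_left h1 hκpos.le
      _ = h₀ := by field_simp
  have hhpos : 0 < h := lt_of_lt_of_le hh₀ hh₀h
  obtain ⟨J, hJ⟩ : ∃ J : ℕ, J = ⌈h / δ⌉₊ := ⟨_, rfl⟩
  obtain ⟨hJ1, hJ2⟩ : h ≤ (J : ℝ) * δ ∧ (J : ℝ) * δ ≤ 2 * h := hJ ▸ ceil_cells hδpos (hδh₀.trans hh₀h)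
  have hJδpos : 0 < (J : ℝ) * δ := lt_of_lt_of_le hhpos hJ1
  obtain ⟨μc, hμcdef⟩ : ∃ μc : ℝ, μc = ((N : ℝ) + 1) ^ 2 * hsDiameter σ N ^ 2 * δ := ⟨_, rfl⟩
  have hμc : μc = s₀ * ((N : ℝ) + 1) := by
    calc μc = κ * (((N : ℝ) + 1) * hsDiameter σ N ^ 3) * ((N : ℝ) + 1) := by rw [hμcdef, hδ]; ring
      _ = s₀ * ((N : ℝ) + 1) := by rw [hε3, hs₀]
  have hs₀μ : s₀ * ((N : ℝ) + 1) ≤ μc := hμc.symm.le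
  have hμcpos : 0 < μc := by rw [hμc]; exact mul_pos hs₀pos hN1
  have hM₀μ : M₀ ≤ μc := by
    rw [hμc]; have := (div_le_iff₀ hs₀pos).1 hT3; linarith only [this]
  have hsq : ((N : ℝ) + 1) ^ 2 * hsDiameter σ N ^ 2 = σ ^ 2 * ((N : ℝ) + 1) ^ (4 / 3 : ℝ) :=
    succ_sq_mul_hsDiameter_sq σ N
  -- measures and the almost sure regularity of the path
  obtain ⟨G, hGdef⟩ : ∃ G : Measure (Config (N + 1) (Fin 3) T3),
      G = localGibbsLaw σ (fun _ => b) (fun _ => w) (fun _ => ϑ) N Φ := ⟨_, rfl⟩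
  obtain ⟨μ, hμ⟩ : ∃ μ : Measure (Config (N + 1) (Fin 3) T3 × (ℕ → V3)), μ = G.prod (lambertNoise (Fin 3)) := ⟨_, rfl⟩
  rw [← hGdef, ← hμ]
  have hε' : hsDiameter σ N < 2⁻¹ := hεσ.trans_lt hσ'
  haveI : IsProbabilityMeasure G := by rw [hGdef]; exact isProbabilityMeasure_localGibbsLaw_const hσ' N w hb hϑ Φ
  have hGac : G ≪ liouville (Torus.geometry (Fin 3)) (N + 1) (hsDiameter σ N) := by
    rw [hGdef]; exact localGibbsLaw_absolutelyContinuous σ _ _ _ N Φ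
  have hH1 := ae_freeExitTime_lambertStateAfter_pos hσ hσ' N G hGac
  have hH2 := ae_nonAccumulation_of_absolutelyContinuous hσ hσ' N G hGac
  rw [← hμ] at hH1 hH2
  have hH3 : ∀ᵐ p ∂μ, p.1 ∈ hardSphereDomain (Torus.geometry (Fin 3)) (N + 1) (hsDiameter σ N) ∧
      ∀ k, freeExitTime (Torus.geometry (Fin 3)) (hsDiameter σ N)
          (lambertStateAfter (Torus.geometry (Fin 3)) (hsDiameter σ N) p.2 p.1 k) ≠ ⊤ →
        IsSimpleIncoming (Torus.geometry (Fin 3)) (hsDiameter σ N)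
          (freeFlight (Torus.geometry (Fin 3))
            (freeExitTime (Torus.geometry (Fin 3)) (hsDiameter σ N)
              (lambertStateAfter (Torus.geometry (Fin 3)) (hsDiameter σ N) p.2 p.1 k)).toReal
            (lambertStateAfter (Torus.geometry (Fin 3)) (hsDiameter σ N) p.2 p.1 k)) := by
    have h0 := (Measure.quasiMeasurePreserving_fst
      (μ := liouville (Torus.geometry (Fin 3)) (N + 1) (hsDiameter σ N)) (ν := lambertNoise (Fin 3))).ae
      (ae_liouville_mem_and_not_mem_contactSet (N := N + 1) hεpos.ne')
    rw [hμ]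
    refine (hGac.prod Measure.AbsolutelyContinuous.rfl).ae_le ?_
    filter_upwards [LambertianContactSwapLambertianEulerFwdGood.lambert_ae_fwdGood hεpos hε' (N := N + 1), h0]
      with p hp hp0
    exact ⟨hp0.1, hp.1⟩
  -- the mark of width `wd` (cell width `δ`, fast threshold `1/2`) and the static shell count
  obtain ⟨mark, hmark⟩ : ∃ mark : ℝ → Fin (N + 1) × Fin (N + 1) → Config (N + 1) (Fin 3) T3 → ℝ, mark = fun wd q y =>
    if (∃ r : Fin (N + 1), r ≠ q.1 ∧ r ≠ q.2 ∧
        ((hsDiameter σ N ≤ ‖(Torus.geometry (Fin 3)).sepVec (y q.1).1 (y r).1‖ ∧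
            ‖(Torus.geometry (Fin 3)).sepVec (y q.1).1 (y r).1‖ ≤ hsDiameter σ N + wd * ‖(y q.1).2 - (y r).2‖) ∨
          (hsDiameter σ N ≤ ‖(Torus.geometry (Fin 3)).sepVec (y q.2).1 (y r).1‖ ∧
            ‖(Torus.geometry (Fin 3)).sepVec (y q.2).1 (y r).1‖ ≤ hsDiameter σ N + wd * ‖(y q.2).2 - (y r).2‖))) ∨
        2⁻¹ ≤ δ * ‖(y q.1).2 - (y q.2).2‖ then (1 : ℝ) else 0 := ⟨_, rfl⟩
  have hmk0 : ∀ wd q y, 0 ≤ mark wd q y := by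
    intro wd q y; simp only [hmark]; split_ifs; exacts [zero_le_one, le_rfl]
  obtain ⟨Fc, hFc'⟩ : ∃ Fc : Config (N + 1) (Fin 3) T3 → ℝ, ∀ y, Fc y = ∑ q : Fin (N + 1) × Fin (N + 1),
    if q.1 ≠ q.2 ∧ hsDiameter σ N ≤ ‖(Torus.geometry (Fin 3)).sepVec (y q.1).1 (y q.2).1‖ ∧
        ‖(Torus.geometry (Fin 3)).sepVec (y q.1).1 (y q.2).1‖ ≤ hsDiameter σ N + δ * ‖(y q.1).2 - (y q.2).2‖
      then (1 : ℝ) else 0 := ⟨_, fun _ => rfl⟩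
  have hFcm : Measurable Fc := by
    rw [show Fc = _ from funext hFc']
    refine Finset.measurable_sum _ fun q _ => ?_
    have hf : Measurable fun y : Config (N + 1) (Fin 3) T3 =>
        ‖(Torus.geometry (Fin 3)).sepVec (y q.1).1 (y q.2).1‖ :=
      (Torus.measurable_geometry_sepVec.comp
        ((measurable_pi_apply q.1).fst.prodMk (measurable_pi_apply q.2).fst)).norm
    have hg : Measurable fun y : Config (N + 1) (Fin 3) T3 => ‖(y q.1).2 - (y q.2).2‖ :=
      ((measurable_pi_apply q.1).snd.sub (measurable_pi_apply q.2).snd).norm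
    exact Measurable.ite ((MeasurableSet.const _).inter ((measurableSet_le measurable_const hf).inter
      (measurableSet_le hf ((hg.const_mul δ).const_add _)))) measurable_const measurable_const
  -- the marked sum over the counted contacts of `(a', a' + Jδ]`
  obtain ⟨MS, hMS'⟩ : ∃ MS : Config (N + 1) (Fin 3) T3 × (ℕ → V3) → ℝ, ∀ p, MS p =
    ∑ m ∈ Finset.range (lambertCount (Torus.geometry (Fin 3)) (hsDiameter σ N) p.2 p.1 (a' + (J : ℝ) * δ)),
      if a' < (lambertInstant (Torus.geometry (Fin 3)) (hsDiameter σ N) p.2 p.1 (m + 1)).toReal then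
        ∑ q : Fin (N + 1) × Fin (N + 1),
          (incomingPairs (Torus.geometry (Fin 3)) (hsDiameter σ N)
            (freeFlight (Torus.geometry (Fin 3))
              (freeExitTime (Torus.geometry (Fin 3)) (hsDiameter σ N)
                (lambertStateAfter (Torus.geometry (Fin 3)) (hsDiameter σ N) p.2 p.1 m)).toReal
              (lambertStateAfter (Torus.geometry (Fin 3)) (hsDiameter σ N) p.2 p.1 m))).indicator
            (fun q' => mark δ q' (freeFlight (Torus.geometry (Fin 3))
              (freeExitTime (Torus.geometry (Fin 3)) (hsDiameter σ N)
                (lambertStateAfter (Torus.geometry (Fin 3)) (hsDiameter σ N) p.2 p.1 m)).toReal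
              (lambertStateAfter (Torus.geometry (Fin 3)) (hsDiameter σ N) p.2 p.1 m))) q
      else 0 := ⟨_, fun _ => rfl⟩
  have hMS0 : ∀ p, 0 ≤ MS p := fun p => (hMS' p).symm ▸ Finset.sum_nonneg fun m _ => by
    split_ifs; exacts [Finset.sum_nonneg fun q _ => Set.indicator_nonneg (fun _ _ => hmk0 _ _ _) _, le_rfl]
  -- Step 1: the pathwise inequality, almost surely
  have h43 : 0 ≤ ((N : ℝ) + 1) ^ (4 / 3 : ℝ) := by positivity
  have hR : (J : ℝ) * (C₀ * μc) ≤ (2 * C₀ * σ ^ 2 + 1) * h * ((N : ℝ) + 1) ^ (4 / 3 : ℝ) := by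
    have e : (J : ℝ) * (C₀ * μc) = C₀ * (σ ^ 2 * ((N : ℝ) + 1) ^ (4 / 3 : ℝ)) * ((J : ℝ) * δ) := by
      rw [hμcdef, ← hsq]; ring
    rw [e, add_mul, add_mul, one_mul]
    calc C₀ * (σ ^ 2 * ((N : ℝ) + 1) ^ (4 / 3 : ℝ)) * ((J : ℝ) * δ)
        ≤ C₀ * (σ ^ 2 * ((N : ℝ) + 1) ^ (4 / 3 : ℝ)) * (2 * h) := mul_le_mul_of_nonneg_left hJ2 (by positivity)
      _ = (2 * C₀ * σ ^ 2) * h * ((N : ℝ) + 1) ^ (4 / 3 : ℝ) := by ring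
      _ ≤ _ := le_add_of_nonneg_right (mul_nonneg hhpos.le h43)
  have hpath : ∀ᵐ p ∂μ, ENNReal.ofReal
      ((((lambertCount (Torus.geometry (Fin 3)) (hsDiameter σ N) p.2 p.1 (a' + h) : ℕ) : ℝ) -
          ((lambertCount (Torus.geometry (Fin 3)) (hsDiameter σ N) p.2 p.1 a' : ℕ) : ℝ)) -
        (2 * C₀ * σ ^ 2 + 1) * h * ((N : ℝ) + 1) ^ (4 / 3 : ℝ)) ≤
      (∑ j ∈ Finset.range J, ENNReal.ofReal
        (Fc (lambertFlow (Torus.geometry (Fin 3)) (hsDiameter σ N) p.2 p.1 (a' + (j : ℝ) * δ)) - C₀ * μc)) +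
        3 * ENNReal.ofReal (MS p) := by
    filter_upwards [hH1, hH2, hH3] with p hpos hacc h3
    -- the charging inequality and the monotonicity of the count
    have hch := windowCount_le_of_noRecollision (G := Torus.geometry (Fin 3)) (ε := hsDiameter σ N)
      (ξs := p.2) (z := p.1) norm_sepVec_le_norm_sepVec_translate_add norm_sepVec_translate_le
      (fun x y => by rw [Torus.norm_geometry_sepVec, Torus.norm_geometry_sepVec, Torus.euclidDist_comm])
      hpos hacc h3.2 (δ := δ) (L := 2⁻¹) hδpos
      (fun x y vx vy u hu huδ hc0 hout hc1 hin => by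
        have h1 := one_sub_two_mul_le_mul_norm_of_recontact (hsDiameter σ N) u x y vx vy hεpos hu hc0 hout hc1 hin
        have h2 : u * ‖vx - vy‖ ≤ δ * ‖vx - vy‖ := mul_le_mul_of_nonneg_right huδ (norm_nonneg _)
        linarith)
      (mark δ) (hmk0 δ)
      (fun q y r hr1 hr2 hsh => by
        simp only [hmark]; rw [if_pos (Or.inl ⟨r, hr1, hr2, hsh⟩)])
      (fun q y hf => by simp only [hmark]; rw [if_pos (Or.inr hf)]) ha' J
    simp only [← hFc', ← hMS'] at hch
    have hmono' : (((lambertCount (Torus.geometry (Fin 3)) (hsDiameter σ N) p.2 p.1 (a' + h) : ℕ) : ℝ)) ≤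
        ((lambertCount (Torus.geometry (Fin 3)) (hsDiameter σ N) p.2 p.1 (a' + (J : ℝ) * δ) : ℕ) : ℝ) := by
      exact_mod_cast lambertCount_mono_of_acc hacc (show a' + h ≤ a' + (J : ℝ) * δ by linarith only [hJ1])
    -- real arithmetic: centre each cell at `C₀ μc`
    have hsum : (∑ j ∈ Finset.range J, Fc (lambertFlow (Torus.geometry (Fin 3)) (hsDiameter σ N) p.2 p.1
        (a' + (j : ℝ) * δ))) = (∑ j ∈ Finset.range J, (Fc (lambertFlow (Torus.geometry (Fin 3)) (hsDiameter σ N)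
          p.2 p.1 (a' + (j : ℝ) * δ)) - C₀ * μc)) + (J : ℝ) * (C₀ * μc) := by
      rw [Finset.sum_sub_distrib, Finset.sum_const, Finset.card_range, nsmul_eq_mul]; ring
    have hle : (((lambertCount (Torus.geometry (Fin 3)) (hsDiameter σ N) p.2 p.1 (a' + h) : ℕ) : ℝ) -
          ((lambertCount (Torus.geometry (Fin 3)) (hsDiameter σ N) p.2 p.1 a' : ℕ) : ℝ)) -
        (2 * C₀ * σ ^ 2 + 1) * h * ((N : ℝ) + 1) ^ (4 / 3 : ℝ) ≤
        (∑ j ∈ Finset.range J, max (Fc (lambertFlow (Torus.geometry (Fin 3)) (hsDiameter σ N) p.2 p.1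
          (a' + (j : ℝ) * δ)) - C₀ * μc) 0) + 3 * MS p := by
      have hmaxs : (∑ j ∈ Finset.range J, (Fc (lambertFlow (Torus.geometry (Fin 3)) (hsDiameter σ N) p.2 p.1
          (a' + (j : ℝ) * δ)) - C₀ * μc)) ≤ ∑ j ∈ Finset.range J, max (Fc (lambertFlow (Torus.geometry (Fin 3))
            (hsDiameter σ N) p.2 p.1 (a' + (j : ℝ) * δ)) - C₀ * μc) 0 :=
        Finset.sum_le_sum fun j _ => le_max_left _ _
      have hch' := hch
      rw [hsum] at hch'
      linarith only [hch', hmaxs, hR, hmono', hMS0 p]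
    -- through `ofReal`
    have hnn : ∀ j ∈ Finset.range J, 0 ≤ max (Fc (lambertFlow (Torus.geometry (Fin 3)) (hsDiameter σ N) p.2 p.1
        (a' + (j : ℝ) * δ)) - C₀ * μc) 0 := fun j _ => le_max_right _ _
    calc ENNReal.ofReal _ ≤ ENNReal.ofReal ((∑ j ∈ Finset.range J, max (Fc (lambertFlow (Torus.geometry (Fin 3))
            (hsDiameter σ N) p.2 p.1 (a' + (j : ℝ) * δ)) - C₀ * μc) 0) + 3 * MS p) := ENNReal.ofReal_le_ofReal hle
      _ = (∑ j ∈ Finset.range J, ENNReal.ofReal (max (Fc (lambertFlow (Torus.geometry (Fin 3))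
            (hsDiameter σ N) p.2 p.1 (a' + (j : ℝ) * δ)) - C₀ * μc) 0)) + 3 * ENNReal.ofReal (MS p) := by
          rw [ENNReal.ofReal_add (Finset.sum_nonneg hnn) (by linarith only [hMS0 p]),
            ENNReal.ofReal_sum_of_nonneg hnn, ENNReal.ofReal_mul (by norm_num), ENNReal.ofReal_ofNat]
      _ = _ := by
          refine congrArg₂ (· + ·) (Finset.sum_congr rfl fun j _ => ?_) rfl
          rcases le_total (Fc (lambertFlow (Torus.geometry (Fin 3)) (hsDiameter σ N) p.2 p.1
            (a' + (j : ℝ) * δ)) - C₀ * μc) 0 with hc | hc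
          · rw [max_eq_right hc, ENNReal.ofReal_of_nonpos hc, ENNReal.ofReal_zero]
          · rw [max_eq_left hc]
  -- Step 2: integrate; the cell terms by stationarity and the static tail, the marks by Campbell
  have hgm : Measurable fun p : Config (N + 1) (Fin 3) T3 × (ℕ → V3) => ∑ j ∈ Finset.range J,
      ENNReal.ofReal (Fc (lambertFlow (Torus.geometry (Fin 3)) (hsDiameter σ N) p.2 p.1 (a' + (j : ℝ) * δ)) -
        C₀ * μc) :=
    Finset.measurable_sum _ fun j _ =>
      ((hFcm.comp (measurable_lambertFlow_hsDiameter hσ.le hσ' N _)).sub measurable_const).ennreal_ofReal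
  have hcell : ∀ j : ℕ, ∫⁻ p, ENNReal.ofReal (Fc (lambertFlow (Torus.geometry (Fin 3)) (hsDiameter σ N) p.2 p.1
      (a' + (j : ℝ) * δ)) - C₀ * μc) ∂μ ≤ ENNReal.ofReal (η' * μc) := by
    intro j
    rw [hμ, hGdef, lintegral_comp_lambertFlow_eq hσ hσ' N b ϑ w hb hϑ Φ (f := fun y => ENNReal.ofReal (Fc y - C₀ * μc))
      ((hFcm.sub measurable_const).ennreal_ofReal) (by positivity)]
    have hkey := hM₀ σ hσ hσ2 hlam N Φ δ hδpos.le hδε hε4 (hμcdef ▸ hs₀μ) (hμcdef ▸ hM₀μ)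
    rw [← hμcdef] at hkey
    simp only [hFc']
    exact hkey
  obtain ⟨Bm, hBm⟩ : ∃ Bm : ℝ,
      Bm = Cm * (((N : ℝ) + 1) * hsDiameter σ N ^ 4 * δ + hsDiameter σ N ^ 2 * δ ^ 2 / (2⁻¹) ^ 2) := ⟨_, rfl⟩
  have hBm0 : 0 ≤ Bm := by rw [hBm]; positivity
  have hstat : ∀ h' : ℝ, 0 ≤ h' → h' ≤ δ → ∀ q : Fin (N + 1) × Fin (N + 1),
      ∫⁻ y, ENNReal.ofReal
          (if q.1 ≠ q.2 ∧ hsDiameter σ N ≤ ‖(Torus.geometry (Fin 3)).sepVec (y q.1).1 (y q.2).1‖ ∧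
              ‖(Torus.geometry (Fin 3)).sepVec (y q.1).1 (y q.2).1‖ ≤ hsDiameter σ N + h' * ‖(y q.1).2 - (y q.2).2‖
            then mark (2 * δ) q y else 0) ∂(localGibbsLaw σ (fun _ => b) (fun _ => w) (fun _ => ϑ) N Φ) ≤
        ENNReal.ofReal (Bm * h') := by
    intro h' hh'0 hh'δ q
    have hkey := hMark σ hσ hσ2 hlam N Φ δ 2⁻¹ h' hδpos h2δ hε4 (by norm_num) hh'0 hh'δ q
    rw [← hBm] at hkey
    have hf : Measurable fun y : Config (N + 1) (Fin 3) T3 =>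
        ‖(Torus.geometry (Fin 3)).sepVec (y q.1).1 (y q.2).1‖ :=
      (Torus.measurable_geometry_sepVec.comp
        ((measurable_pi_apply q.1).fst.prodMk (measurable_pi_apply q.2).fst)).norm
    have hg : Measurable fun y : Config (N + 1) (Fin 3) T3 => ‖(y q.1).2 - (y q.2).2‖ :=
      ((measurable_pi_apply q.1).snd.sub (measurable_pi_apply q.2).snd).norm
    have hAm : MeasurableSet {y : Config (N + 1) (Fin 3) T3 | q.1 ≠ q.2 ∧
        hsDiameter σ N ≤ ‖(Torus.geometry (Fin 3)).sepVec (y q.1).1 (y q.2).1‖ ∧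
          ‖(Torus.geometry (Fin 3)).sepVec (y q.1).1 (y q.2).1‖ ≤ hsDiameter σ N + h' * ‖(y q.1).2 - (y q.2).2‖} :=
      (MeasurableSet.const _).inter ((measurableSet_le measurable_const hf).inter
        (measurableSet_le hf ((hg.const_mul h').const_add _)))
    have hBm := measurableSet_mark N (hsDiameter σ N) (2 * δ) δ q
    refine le_trans (le_of_eq ?_) hkey
    rw [Set.setOf_and, ← lintegral_indicator_one (hAm.inter hBm)]
    refine lintegral_congr fun y => ?_
    simp only [hmark]
    by_cases hA : q.1 ≠ q.2 ∧ hsDiameter σ N ≤ ‖(Torus.geometry (Fin 3)).sepVec (y q.1).1 (y q.2).1‖ ∧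
        ‖(Torus.geometry (Fin 3)).sepVec (y q.1).1 (y q.2).1‖ ≤ hsDiameter σ N + h' * ‖(y q.1).2 - (y q.2).2‖
    · by_cases hB : (∃ r : Fin (N + 1), r ≠ q.1 ∧ r ≠ q.2 ∧
          ((hsDiameter σ N ≤ ‖(Torus.geometry (Fin 3)).sepVec (y q.1).1 (y r).1‖ ∧
              ‖(Torus.geometry (Fin 3)).sepVec (y q.1).1 (y r).1‖ ≤ hsDiameter σ N + (2 * δ) * ‖(y q.1).2 - (y r).2‖) ∨
            (hsDiameter σ N ≤ ‖(Torus.geometry (Fin 3)).sepVec (y q.2).1 (y r).1‖ ∧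
              ‖(Torus.geometry (Fin 3)).sepVec (y q.2).1 (y r).1‖ ≤ hsDiameter σ N + (2 * δ) * ‖(y q.2).2 - (y r).2‖))) ∨
          2⁻¹ ≤ δ * ‖(y q.1).2 - (y q.2).2‖
      · rw [if_pos hA, if_pos hB, Set.indicator_of_mem, Pi.one_apply, ENNReal.ofReal_one]
        exact ⟨hA, hB⟩
      · rw [if_pos hA, if_neg hB, Set.indicator_of_notMem, ENNReal.ofReal_zero]
        exact fun h => hB h.2
    · rw [if_neg hA, Set.indicator_of_notMem, ENNReal.ofReal_zero]
      exact fun h => hA h.1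
  -- Campbell's bound for the marked contacts of `(a', a' + Jδ]`
  have htrans : ∀ (q : Fin (N + 1) × Fin (N + 1)) (y : Config (N + 1) (Fin 3) T3) (u : ℝ),
      y ∈ hardSphereDomain (Torus.geometry (Fin 3)) (N + 1) (hsDiameter σ N) → 0 ≤ u → u ≤ δ →
      mark δ q (freeFlight (Torus.geometry (Fin 3)) u y) ≤ mark (2 * δ) q y :=
    fun q y u hy hu huδ => by
      simp only [hmark]; exact markInd_freeFlight_le N (hsDiameter σ N) δ q y u hy hu huδ
  have hwt'm : ∀ q, Measurable fun y => mark (2 * δ) q y := fun q => by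
    simp only [hmark]; exact measurable_markInd N (hsDiameter σ N) (2 * δ) δ q
  have hcamp : ∫⁻ p, ENNReal.ofReal (MS p) ∂μ ≤ ENNReal.ofReal (((N : ℝ) + 1) ^ 2 * Bm * ((J : ℝ) * δ)) := by
    simp only [hMS', hμ, hGdef]
    exact lintegral_configMarkedContacts_le hσ hσ' N b ϑ w hb hϑ Φ (mark δ) (mark (2 * δ)) (hmk0 (2 * δ)) hwt'm
      δ hδpos htrans Bm hBm0 hstat a' ((J : ℝ) * δ) ha' hJδpos
  -- the real bookkeeping: `J η' μc + 3 (N+1)² Bm Jδ ≤ η h (N+1)^{4/3}` (`cells_bookkeeping`)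
  have hreal : (J : ℝ) * (η' * μc) + 3 * (((N : ℝ) + 1) ^ 2 * Bm * ((J : ℝ) * δ)) ≤
      η * h * ((N : ℝ) + 1) ^ (4 / 3 : ℝ) := by
    have hkey := cells_bookkeeping σ η Cm κ (hsDiameter σ N) δ h (J : ℝ) ((N : ℝ) + 1)
      (((N : ℝ) + 1) ^ (4 / 3 : ℝ)) (((N : ℝ) + 1) ^ 2 * hsDiameter σ N ^ 2) hσ hη hCm hκpos hκle1 hκ1 hκ2
      hεpos hε4 hδ hhpos (Nat.cast_nonneg J) hJ2 hN1 h43 hε3 rfl hsq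
    rw [hη', hμcdef, hBm]
    convert hkey using 2
  -- Step 3: integrate the pathwise inequality
  have hgjm : ∀ j : ℕ, Measurable fun p : Config (N + 1) (Fin 3) T3 × (ℕ → V3) =>
      ENNReal.ofReal (Fc (lambertFlow (Torus.geometry (Fin 3)) (hsDiameter σ N) p.2 p.1 (a' + (j : ℝ) * δ)) -
        C₀ * μc) := fun j =>
    ((hFcm.comp (measurable_lambertFlow_hsDiameter hσ.le hσ' N _)).sub measurable_const).ennreal_ofReal
  calc ∫⁻ p, _ ∂μ
      ≤ ∫⁻ p, ((∑ j ∈ Finset.range J, ENNReal.ofReal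
          (Fc (lambertFlow (Torus.geometry (Fin 3)) (hsDiameter σ N) p.2 p.1 (a' + (j : ℝ) * δ)) - C₀ * μc)) +
          3 * ENNReal.ofReal (MS p)) ∂μ := lintegral_mono_ae hpath
    _ = (∑ j ∈ Finset.range J, ∫⁻ p, ENNReal.ofReal
          (Fc (lambertFlow (Torus.geometry (Fin 3)) (hsDiameter σ N) p.2 p.1 (a' + (j : ℝ) * δ)) - C₀ * μc) ∂μ) +
          3 * ∫⁻ p, ENNReal.ofReal (MS p) ∂μ := by
        rw [lintegral_add_left hgm, lintegral_finsetSum _ fun j _ => hgjm j,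
          lintegral_const_mul' _ _ (by norm_num)]
    _ ≤ (∑ _j ∈ Finset.range J, ENNReal.ofReal (η' * μc)) +
          3 * ENNReal.ofReal (((N : ℝ) + 1) ^ 2 * Bm * ((J : ℝ) * δ)) :=
        add_le_add (Finset.sum_le_sum fun j _ => hcell j) (by gcongr)
    _ = ENNReal.ofReal ((J : ℝ) * (η' * μc) + 3 * (((N : ℝ) + 1) ^ 2 * Bm * ((J : ℝ) * δ))) := by
        rw [Finset.sum_const, Finset.card_range, nsmul_eq_mul, natCast_mul_ofReal,
          show (3 : ℝ≥0∞) = ENNReal.ofReal 3 by norm_num, ← ENNReal.ofReal_mul (by norm_num),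
          ← ENNReal.ofReal_add (mul_nonneg (Nat.cast_nonneg _) (mul_nonneg hη'pos.le hμcpos.le))
            (mul_nonneg (by norm_num) (mul_nonneg (mul_nonneg (by positivity) hBm0) hJδpos.le))]
    _ ≤ ENNReal.ofReal (η * h * ((N : ℝ) + 1) ^ (4 / 3 : ℝ)) := ENNReal.ofReal_le_ofReal hreal

end Summit.AtomisticToContinuum.HydrodynamicLimit.Theorems.LambertianContactSwapLambertianEulerWindowCountConcentration

end
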